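import Summits.QuantumFields.BalabanUV.T4Continuum.Support.B13ReadingsDecay

/-!
# B13ReadingsLevelShift — the W1 readings of record are LEVEL-SHIFTED (run B reads the tower one level deeper); same-level covariance
# slots cannot inhabit them unless the tower is level-constant on the read entries (located typing point F-ne5p1-g37-1, ruling R53)

Cell `pub-balaban`, unit `b2b-balaban-t4-ne5-p1` (row NE5 OWNER, gen 37; owner item «g37-b», ruling R53; the readings `ReadsTowerCovA` ∕
`ReadsTowerCovB` are this lineage's W1 readings OF RECORD, `B13ReadingsDecay` p219966, gen 33).  Summits-side NEW WORK under the LEAN PLACEMENT RULE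
([folklore] bookkeeping over ABSTRACT towers, slots and index maps + one toy; nothing printed is asserted; no `[cite:]`; no `Prop`-valued fact minted;
0 `def`).  HONEST FRAMING: rung (B)+1 of the FINITE-VOLUME T⁴ continuum programme — NOT infinite volume, NOT a mass gap, NOT the Clay problem, NOT a
proof of NE5 (NOT PRINTED; GAPS G-t4-U3-1), NOT a proof of NE2 or NE3.  HONEST DEPENDENCY (cell, verbatim): continuum YM on T⁴ ⇐ BetaPertH ∧ nine
spine estimates (0/9 proved); BetaPertH ⇐ (D1) ∧ (D4) ∧ CAP+tail; G-an2-4 gates asym, D1 and NE2/3/4.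

WHY.  `ReadsTowerCovA c σ tow rawA W` says run A's step-`k` covariance entry IS the level-`k` kernel of the tower member `tow k g U`;
`ReadsTowerCovB c σ tow rawB W` says run B's entry at the PAIRED step is the level-`k + 1` kernel of the SAME member («one more fine level» — the
aligned run-B term is created with its original lattice one level deeper below the common block lattice; printed kinematics [Balaban1987RG1]
(2.3) p. 265, the `k`-fold composition defining the step-`k` quadratic form [Balaban1984PropagatorsI] (1.17)–(1.19) p. 20 — KIND only, nothing
asserted).  If an instance supplies the two runs' covariance slots as the SAME-LEVEL species of two towers that COINCIDE at related backgrounds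
(the substrate's `slotsOfRecord` read through W-20 `covAtOfRecord_carriers_transport`: run A's species of record at `transport U` = run B's at
`U`, level by level, at a common contour letter `Γ`; with separate `ΓA`, `ΓB` the forced identity becomes «tower increment = contour-letter variation»,
`b2b-balaban-t4-ne5-formalise-leaf-01` gen 18's kernel probe K8″, `HOME/CLAIMS.log` l.19805 — same conclusion for the towers of interest), then both readings
together force the tower to be LEVEL-CONSTANT on every read entry (§1) — which the towers of interest
are not (the unit-lattice covariance changes when a fine level is added: `B5G183RateUnitTower` §11, King (4.18)∕(4.38) shape; toy §3).  So at
such an instance the pair of reading binders is jointly uninhabitable as typed (§2): the located typing point F-ne5p1-g37-1.  §4 types the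
repair of ruling R53: run B's covariance slot reads the SAME species family ONE LEVEL DEEPER at the same datum — then both readings hold by
`rfl`-shaped hypotheses, and W1 for the covariance species is the tower's TWO-LEVEL rate at the related background (`B13ReadingsDecay` §1 ∕
`B13ReadingsDelta`, rows NE2 ∧ NE3's currency) — not zero (§5).  Ruling R54 (`HOME/CLAIMS.log` l.19952) fixes the substrate-side shape: the shift is
COV-ONLY at the ALIGNED index (run B's `.cov` slot reads depth `k + 1`; couplings stay pre-shifted by `gBre`; free tables are not relabelled) — the
substrate's offered W-21 `SubstrateSlotsOfRecordShift` (l.19906) is to inhabit §4's hypotheses with a step-blind datum.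

WHAT ([folklore]; 0 def).
* `tower_levelConstant_of_sameLevelCov` ∕ `tower_const_of_sameLevelCov_stepBlind` (§1), `not_sameLevelCov_of_towerStep` (§2), `exists_tower_no_sameLevelCov`
  (§3, toy: the scalar tower `k ↦ k` on a one-point index set), `readsTowerCov_of_shiftedSlots` (§4), `cov_entryBound_of_shiftedSlots` (§5: §4 ∘
  `B13ReadingsDecay.cov_entryBound_of_twoLevelDecayRate` — W1 for the covariance species IS the tower's two-level rate).
Companion (same gen, g37-c): `B13ReadingsLevelWindow` — the LEVEL-WINDOWED twins `ReadsTowerCovAOn S` ∕ `ReadsTowerCovBOn S` of the readings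
(substrate-typer T-S19 ∕ ruling R55: above run A's top level both runs' record cov slots are junk, so instances display the readings on `{k | k ≤ K}`).
0 sorry; axioms ⊆ {propext, Classical.choice, Quot.sound}.
-/

noncomputable section

open scoped BigOperators Matrix

namespace Summit.QuantumFields.BalabanUV.T4Continuum.B13ReadingsLevelShift

open Summit.QuantumFields.BalabanUV.T4Continuum.B13OpDatum
open Summit.QuantumFields.BalabanUV.T4Continuum.B13ReadingsDecay (ReadsTowerCovA ReadsTowerCovB CovWeightDominatesDist
  cov_entryBound_of_twoLevelDecayRate)
open Summit.QuantumFields.BalabanUV.T4Continuum.DecayRateInterpolation (TwoLevelDecayRate)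

variable {T κ ι Ω 𝒴 Bg J n : Type*}

/-! ## §1 Same-level slots + the shifted readings ⇒ the tower is level-constant on the read entries -/

/-- [folklore] **SAME-LEVEL COVARIANCE SLOTS FORCE A LEVEL-CONSTANT TOWER.**  If run A's and run B's raw covariance slots inhabit the W1
readings of record (`ReadsTowerCovA`: level `k`; `ReadsTowerCovB`: level `k + 1` of the SAME member `tow k g U`) AND the two slots coincide
entry by entry at every step (`hsame` — what same-level species of two towers that agree at related backgrounds give), then the tower member
read at step `k` has the SAME kernel at levels `k` and `k + 1` on every read entry `(σ t p, σ t q)`. -/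
theorem tower_levelConstant_of_sameLevelCov {c : J → ℕ → Matrix n n ℂ} {σ : T → κ → n} {tow : ℕ → (ℕ → ℝ) → Bg → J}
    {rawA rawB : (ℕ → ℝ) → Bg → ℕ → RawSpecies T κ ι Ω 𝒴} {W : Set (ℕ → ℝ)}
    (hA : ReadsTowerCovA c σ tow rawA W) (hB : ReadsTowerCovB c σ tow rawB W)
    (hsame : ∀ k, ∀ g ∈ W, ∀ (U : Bg) (t : T) (p q : κ), (rawA g U k).cov t p q = (rawB g U k).cov t p q) :
    ∀ k, ∀ g ∈ W, ∀ (U : Bg) (t : T) (p q : κ), c (tow k g U) k (σ t p) (σ t q) = c (tow k g U) (k + 1) (σ t p) (σ t q) := by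
  intro k g hg U t p q
  rw [← hA k g hg U t p q, ← hB k g hg U t p q]
  exact hsame k g hg U t p q

/-- [folklore] Iterated along a STEP-BLIND datum (`tow k g U = tow 0 g U` for all `k`): the member's kernel on the read entries is the same at
EVERY level `k ≤ m` as at level `0`. -/
theorem tower_const_of_sameLevelCov_stepBlind {c : J → ℕ → Matrix n n ℂ} {σ : T → κ → n} {tow : ℕ → (ℕ → ℝ) → Bg → J}
    {rawA rawB : (ℕ → ℝ) → Bg → ℕ → RawSpecies T κ ι Ω 𝒴} {W : Set (ℕ → ℝ)}
    (hA : ReadsTowerCovA c σ tow rawA W) (hB : ReadsTowerCovB c σ tow rawB W)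
    (hsame : ∀ k, ∀ g ∈ W, ∀ (U : Bg) (t : T) (p q : κ), (rawA g U k).cov t p q = (rawB g U k).cov t p q)
    (hblind : ∀ k g U, tow k g U = tow 0 g U) :
    ∀ m, ∀ g ∈ W, ∀ (U : Bg) (t : T) (p q : κ), c (tow 0 g U) m (σ t p) (σ t q) = c (tow 0 g U) 0 (σ t p) (σ t q) := by
  intro m g hg U t p q
  induction m with
  | zero => rfl
  | succ m ih =>
      have h := tower_levelConstant_of_sameLevelCov hA hB hsame m g hg U t p q
      rw [hblind m g U] at h
      rw [← h, ih]

/-! ## §2 Hence: a tower that moves between two consecutive levels on ONE read entry admits no same-level slot pair -/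

/-- [folklore] **NO SAME-LEVEL SLOT PAIR FOR A TOWER WITH A LEVEL STEP ON A READ ENTRY.**  If for some step `k`, couplings `g ∈ W`, background
`U`, slot `t` and entry `(p, q)` the member `tow k g U` has DIFFERENT kernels at levels `k` and `k + 1` on `(σ t p, σ t q)`, then NO pair of raw
suppliers inhabits `ReadsTowerCovA ∧ ReadsTowerCovB` while coinciding entrywise — the located typing point F-ne5p1-g37-1 (the substrate's
same-level `.cov` slots at related backgrounds vs the level-shifted readings of record). -/
theorem not_sameLevelCov_of_towerStep {c : J → ℕ → Matrix n n ℂ} {σ : T → κ → n} {tow : ℕ → (ℕ → ℝ) → Bg → J} {W : Set (ℕ → ℝ)}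
    {k : ℕ} {g : ℕ → ℝ} (hg : g ∈ W) {U : Bg} {t : T} {p q : κ}
    (hstep : c (tow k g U) k (σ t p) (σ t q) ≠ c (tow k g U) (k + 1) (σ t p) (σ t q)) :
    ¬ ∃ rawA rawB : (ℕ → ℝ) → Bg → ℕ → RawSpecies T κ ι Ω 𝒴,
      ReadsTowerCovA c σ tow rawA W ∧ ReadsTowerCovB c σ tow rawB W ∧
        ∀ k, ∀ g ∈ W, ∀ (U : Bg) (t : T) (p q : κ), (rawA g U k).cov t p q = (rawB g U k).cov t p q := by
  rintro ⟨rawA, rawB, hA, hB, hsame⟩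
  exact hstep (tower_levelConstant_of_sameLevelCov hA hB hsame k g hg U t p q)

/-! ## §3 Toy: the scalar tower `k ↦ k` -/

/-- [folklore] **NON-VACUITY OF §2**: there is a tower (the scalar tower `k ↦ k·1` on a one-point index set, one-point datum ∕ slot ∕ entry ∕
background types) for which NO same-level slot pair inhabits the two readings of record on any window containing a coupling sequence — the
towers of interest move between consecutive levels just so (the unit-lattice covariance changes when a fine level is added). -/
theorem exists_tower_no_sameLevelCov {W : Set (ℕ → ℝ)} (hW : W.Nonempty) :
    ∃ (c : Unit → ℕ → Matrix Unit Unit ℂ) (σ : Unit → Unit → Unit) (tow : ℕ → (ℕ → ℝ) → Unit → Unit),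
      ¬ ∃ rawA rawB : (ℕ → ℝ) → Unit → ℕ → RawSpecies Unit Unit ι Ω 𝒴,
        ReadsTowerCovA c σ tow rawA W ∧ ReadsTowerCovB c σ tow rawB W ∧
          ∀ k, ∀ g ∈ W, ∀ (U : Unit) (t : Unit) (p q : Unit), (rawA g U k).cov t p q = (rawB g U k).cov t p q := by
  obtain ⟨g, hg⟩ := hW
  refine ⟨fun _ k => Matrix.of fun _ _ => (k : ℂ), fun _ _ => (), fun _ _ _ => (), ?_⟩
  exact not_sameLevelCov_of_towerStep (k := 0) hg (U := ()) (t := ()) (p := ()) (q := ()) (by simp)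

/-! ## §4 The repair of ruling R53: run B's slot reads the same species family one level deeper -/

/-- [folklore] **SHIFTED SLOTS INHABIT THE SHIFTED READINGS.**  If both runs' covariance slots read ONE species family of a datum and a level —
run A at level `k`, run B at level `k + 1` of the SAME datum `d g U` (the aligned run-B term has one more fine level below the common block
lattice) — and that family IS the tower's kernel through `σ`, then `ReadsTowerCovA ∧ ReadsTowerCovB` hold with the step-blind reading map
`tow k g U := d g U`.  (W1 for the covariance species is then the tower's two-level rate at the related background — `B13ReadingsDecay`
`cov_entryBound_of_twoLevelDecayRate` BY NAME — not zero.) -/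
theorem readsTowerCov_of_shiftedSlots {c : J → ℕ → Matrix n n ℂ} {σ : T → κ → n} (d : (ℕ → ℝ) → Bg → J)
    {sp : J → ℕ → T → κ → κ → ℂ} {rawA rawB : (ℕ → ℝ) → Bg → ℕ → RawSpecies T κ ι Ω 𝒴} {W : Set (ℕ → ℝ)}
    (hsp : ∀ j m t p q, sp j m t p q = c j m (σ t p) (σ t q))
    (hA : ∀ k, ∀ g ∈ W, ∀ (U : Bg) (t : T) (p q : κ), (rawA g U k).cov t p q = sp (d g U) k t p q)
    (hB : ∀ k, ∀ g ∈ W, ∀ (U : Bg) (t : T) (p q : κ), (rawB g U k).cov t p q = sp (d g U) (k + 1) t p q) :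
    ReadsTowerCovA c σ (fun _ g U => d g U) rawA W ∧ ReadsTowerCovB c σ (fun _ g U => d g U) rawB W :=
  ⟨fun k g hg U t p q => by rw [hA k g hg U t p q, hsp], fun k g hg U t p q => by rw [hB k g hg U t p q, hsp]⟩

/-! ## §5 … and then W1 for the covariance species IS the tower's two-level rate (composition BY NAME) -/

/-- [folklore] **SHIFTED SLOTS + THE TOWER's TWO-LEVEL RATE ⟹ THE COVARIANCE ENTRY BOUND OF W1** — §4 composed with
`B13ReadingsDecay.cov_entryBound_of_twoLevelDecayRate` BY NAME: with run B's slot one level deeper at the same datum, a `TwoLevelDecayRate` of every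
tower member (rows NE2 ∧ NE3's currency) and the weight domination give `‖covA − covB‖ ≤ B·θ^k·wt` entry by entry — the W1 content for the
covariance species is the two-level rate, NOT zero. -/
theorem cov_entryBound_of_shiftedSlots {Fk : ℕ → Format (Species T κ ι Ω 𝒴)} {c : J → ℕ → Matrix n n ℂ} {σ : T → κ → n}
    (d : (ℕ → ℝ) → Bg → J) {sp : J → ℕ → T → κ → κ → ℂ} {rawA rawB : (ℕ → ℝ) → Bg → ℕ → RawSpecies T κ ι Ω 𝒴} {W : Set (ℕ → ℝ)}
    {dist : n → n → ℝ} {B δ θ : ℝ} (hB : 0 ≤ B) (hθ : 0 ≤ θ)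
    (hsp : ∀ j m t p q, sp j m t p q = c j m (σ t p) (σ t q))
    (hA : ∀ k, ∀ g ∈ W, ∀ (U : Bg) (t : T) (p q : κ), (rawA g U k).cov t p q = sp (d g U) k t p q)
    (hB' : ∀ k, ∀ g ∈ W, ∀ (U : Bg) (t : T) (p q : κ), (rawB g U k).cov t p q = sp (d g U) (k + 1) t p q)
    (hrate : ∀ j, TwoLevelDecayRate dist (c j) B δ θ) (hdom : CovWeightDominatesDist Fk dist σ δ)
    (k : ℕ) {g : ℕ → ℝ} (hg : g ∈ W) (U : Bg) (t : T) (p q : κ) :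
    ‖(rawA g U k).cov t p q - (rawB g U k).cov t p q‖ ≤ B * θ ^ k * (Fk k).wt (.cov t p q) := by
  obtain ⟨hrA, hrB⟩ := readsTowerCov_of_shiftedSlots (c := c) (σ := σ) d hsp hA hB'
  exact cov_entryBound_of_twoLevelDecayRate hB hθ hrate hrA hrB hdom k hg U t p q

end Summit.QuantumFields.BalabanUV.T4Continuum.B13ReadingsLevelShift

end
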